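import Literature.NumberTheory.Automorphic.HeckeAlgebra
import HarnessLib

/-!
# The `ℋ(G, K)`-module `V^K` — discharge of `exists_algHom_moduleEnd_fixedPoints`

This file proves the named fact
`Literature.NumberTheory.Automorphic.exists_algHom_moduleEnd_fixedPoints` of
`Literature/NumberTheory/Automorphic/HeckeAlgebra.lean`: for a Hecke pair `(G, K)`, a commutative
ring `k` and any representation `ρ` of `G` on a `k`-module `V`, the `K`-fixed vectors
`V^K = ρ.fixedPoints K` carry a right module structure over the Hecke algebra
`ℋ(G, K) = End_G(k[G ⧸ K])` (`heckeAlgebra k G K`), i.e. a `k`-algebra map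
`ℋ(G, K)ᵐᵒᵖ →ₐ[k] End_k(V^K)`, under which an element `T` with `T [K] = 𝟙_{KgK}` acts by the
Hecke operator `[KgK] = ∑_{yK ⊆ KgK} ρ(y)` (`heckeOperator ρ K g`)
(Cartier 1979, §IV.1, the locator carried by the fact; Bushnell–Henniart 2006, §4.2; Bump 1997,
§4.2, the paragraph preceding Proposition 4.2.3: "The space `V^{K₀}` is clearly stable under
`ℋ_{K₀}` and is a `ℋ_{K₀}`-module").

## Proof (Frobenius reciprocity)

For `v ∈ V` let `Φ(·) v : k[G ⧸ K] → V` be the `k`-linear map `[yK] ↦ ρ(ỹ) v`, `ỹ = Quotient.out`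
(`heckeAlgebra.liftRep K ρ`, valued in `End_k V` so that it is visibly linear in `v` too). For
`v ∈ V^K` it does not depend on the representatives (`liftRep_single_coe_apply`) and is
`G`-equivariant (`liftRep_ofMulAction_apply`): this is the Frobenius reciprocity isomorphism
`V^K ≅ Hom_G(k[G ⧸ K], V)`, `v ↦ Φ(·) v`, with inverse `φ ↦ φ [K]`. Precomposition with
`T ∈ End_G(k[G ⧸ K])` is a right action on `Hom_G(k[G ⧸ K], V)`; transported to `V^K` it reads
`v · T = Φ(T [K]) v` (`heckeAlgebra.fixedPointsAction`), which lies in `V^K` because `T [K]` is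
`K`-invariant (`liftRep_heckeAlgebra_apply_mem_fixedPoints`). The module law
`(v · S) · T = v · (S T)` is the identity `Φ(f) (Φ(S [K]) v) = Φ(S f) v`
(`liftRep_apply_liftRep_heckeAlgebra_apply`), checked on basis vectors `f = [xK] = x • [K]` using
equivariance of `Φ(·) v` and of `S`; whence the algebra map `heckeAlgebra.fixedPointsAlgHom` out
of the opposite algebra. Finally `Φ(𝟙_{KgK}) = ∑_{yK ⊆ KgK} ρ(ỹ) = heckeOperator ρ K g`
(`liftRep_doubleCosetIndicator`), the sum being finite for a Hecke pair (`finite_orbit_quotient`).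

## References

* P. Cartier, *Representations of p-adic groups: a survey*, Proc. Sympos. Pure Math. 33 (1979),
  part 1, 111–155, §IV.1 [Cartier1979].
* C. Bushnell, G. Henniart, *The local Langlands conjecture for GL(2)*, Springer 2006, §4.2.
* D. Bump, *Automorphic forms and representations*, Cambridge Stud. Adv. Math. 55, 1997, §4.2
  (paragraph preceding Proposition 4.2.3) and Proposition 4.1.2 (Mackey/Frobenius).
-/

open scoped Pointwise
open MonoidAlgebra

namespace Literature.NumberTheory.Automorphic

namespace heckeAlgebra

section FixedPointsModule

open Representation

variable {k G : Type*} [CommRing k] [Group G] (K : Subgroup G)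
  {V : Type*} [AddCommGroup V] [Module k V] (ρ : Representation k G V)

/-- The `k`-linear map `Φ : k[G ⧸ K] → End_k(V)`, `[yK] ↦ ρ(ỹ)` with `ỹ = Quotient.out (yK)` the
chosen representative. Evaluated at a `K`-fixed vector `v`, `f ↦ Φ(f) v` is the Frobenius
reciprocity map `k[G ⧸ K] → V`, `[yK] ↦ ρ(y) v`, independent of representatives
(`liftRep_single_coe_apply`) and `G`-equivariant (`liftRep_ofMulAction_apply`)
(Bump 1997, Proposition 4.1.2; Bushnell–Henniart 2006, §4.2). Off `V^K` its values depend on the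
choice of representatives (junk). [folklore] -/
noncomputable def liftRep : MonoidAlgebra k (G ⧸ K) →ₗ[k] Module.End k V :=
  Finsupp.linearCombination k (fun y : G ⧸ K => ρ y.out) ∘ₗ
    (MonoidAlgebra.coeffLinearEquiv k).toLinearMap

/-- `liftRep` on a basis vector: `Φ(r • [yK]) = r • ρ(ỹ)`. [folklore] -/
theorem liftRep_single (y : G ⧸ K) (r : k) :
    liftRep K ρ (MonoidAlgebra.single y r) = r • ρ y.out := by
  simp [liftRep, Finsupp.linearCombination_single]

/-- On a `K`-fixed vector, `Φ(r • [xK]) v = r • ρ(x) v` for *any* representative `x`. [folklore] -/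
theorem liftRep_single_coe_apply {v : V} (hv : v ∈ ρ.fixedPoints K) (x : G) (r : k) :
    liftRep K ρ (MonoidAlgebra.single (x : G ⧸ K) r) v = r • ρ x v := by
  rw [liftRep_single, LinearMap.smul_apply]
  obtain ⟨h, H⟩ := QuotientGroup.mk_out_eq_mul K x
  rw [H, map_mul, Module.End.mul_apply, (ρ.mem_fixedPoints K v).1 hv _ h.2]

/-- On a `K`-fixed vector, `Φ([K]) v = v`. [folklore] -/
theorem liftRep_single_one_apply {v : V} (hv : v ∈ ρ.fixedPoints K) :
    liftRep K ρ (MonoidAlgebra.single ((1 : G) : G ⧸ K) 1) v = v := by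
  rw [liftRep_single_coe_apply K ρ hv, map_one, Module.End.one_apply, one_smul]

/-- **Frobenius reciprocity, equivariance.** For `v ∈ V^K` the map `f ↦ Φ(f) v`,
`k[G ⧸ K] → V`, is `G`-equivariant: `Φ(g • f) v = ρ(g) (Φ(f) v)`
(Bump 1997, Proposition 4.1.2). [folklore] -/
theorem liftRep_ofMulAction_apply {v : V} (hv : v ∈ ρ.fixedPoints K) (g : G)
    (f : MonoidAlgebra k (G ⧸ K)) :
    liftRep K ρ (ofMulAction k G (G ⧸ K) g f) v = ρ g (liftRep K ρ f v) := by
  induction f using MonoidAlgebra.induction_linear with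
  | zero => simp
  | add x y hx hy => simp [map_add, hx, hy]
  | single y r =>
    induction y using QuotientGroup.induction_on with
    | H x =>
      rw [ofMulAction_single, MulAction.Quotient.smul_coe, smul_eq_mul,
        liftRep_single_coe_apply K ρ hv, liftRep_single_coe_apply K ρ hv, map_smul, map_mul,
        Module.End.mul_apply]

/-- For `T ∈ ℋ(G, K)` and `v ∈ V^K`, the vector `Φ(T [K]) v` is again `K`-fixed, because
`T [K]` is `K`-invariant. [folklore] -/
theorem liftRep_heckeAlgebra_apply_mem_fixedPoints {v : V} (hv : v ∈ ρ.fixedPoints K)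
    (T : heckeAlgebra k G K) :
    liftRep K ρ ((T : Module.End k (MonoidAlgebra k (G ⧸ K)))
      (MonoidAlgebra.single ((1 : G) : G ⧸ K) 1)) v ∈ ρ.fixedPoints K := by
  rw [mem_fixedPoints]
  intro a ha
  -- `T` commutes with `ρ(a)` and `a • [K] = [K]` for `a ∈ K`, so `a • T [K] = T [K]`
  have hT := LinearMap.congr_fun ((mem_heckeAlgebra_iff (T : Module.End k _)).1 T.2 a)
    (MonoidAlgebra.single ((1 : G) : G ⧸ K) 1)
  simp only [Module.End.mul_apply] at hT
  have ha1 : ((a : G) : G ⧸ K) = ((1 : G) : G ⧸ K) := by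
    rw [QuotientGroup.eq, mul_one]
    exact K.inv_mem ha
  rw [← liftRep_ofMulAction_apply K ρ hv, hT, ofMulAction_single, MulAction.Quotient.smul_coe,
    smul_eq_mul, mul_one, ha1]

/-- **Module law.** For `S ∈ ℋ(G, K)`, `v ∈ V^K` and every `f ∈ k[G ⧸ K]`:
`Φ(f) (Φ(S [K]) v) = Φ(S f) v`, i.e. under Frobenius reciprocity the vector `Φ(S [K]) v ∈ V^K`
corresponds to the `G`-map `Φ(·) v ∘ S`. Checked on `f = [xK] = x • [K]` using the equivariance
of `Φ(·) v` and of `S`. [folklore] -/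
theorem liftRep_apply_liftRep_heckeAlgebra_apply {v : V} (hv : v ∈ ρ.fixedPoints K)
    (S : heckeAlgebra k G K) (f : MonoidAlgebra k (G ⧸ K)) :
    liftRep K ρ f (liftRep K ρ ((S : Module.End k (MonoidAlgebra k (G ⧸ K)))
      (MonoidAlgebra.single ((1 : G) : G ⧸ K) 1)) v) =
      liftRep K ρ ((S : Module.End k (MonoidAlgebra k (G ⧸ K))) f) v := by
  induction f using MonoidAlgebra.induction_linear with
  | zero => simp
  | add x y hx hy => simp [map_add, hx, hy]
  | single y r =>
    induction y using QuotientGroup.induction_on with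
    | H x =>
      have hsingle : MonoidAlgebra.single (x : G ⧸ K) r =
          r • ofMulAction k G (G ⧸ K) x (MonoidAlgebra.single ((1 : G) : G ⧸ K) 1) := by
        rw [ofMulAction_single, MulAction.Quotient.smul_coe, smul_eq_mul, mul_one,
          MonoidAlgebra.smul_single', mul_one]
      -- `S` commutes with `ρ(x)`
      have hS := LinearMap.congr_fun ((mem_heckeAlgebra_iff (S : Module.End k _)).1 S.2 x)
        (MonoidAlgebra.single ((1 : G) : G ⧸ K) 1)
      simp only [Module.End.mul_apply] at hS
      rw [liftRep_single_coe_apply K ρ (liftRep_heckeAlgebra_apply_mem_fixedPoints K ρ hv S),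
        hsingle, map_smul, map_smul, LinearMap.smul_apply, ← hS,
        liftRep_ofMulAction_apply K ρ hv]

/-- The right action of `T ∈ ℋ(G, K)` on `V^K`, `v ↦ Φ(T [K]) v`: precomposition with `T`
transported along Frobenius reciprocity `V^K ≅ Hom_G(k[G ⧸ K], V)`; `k`-linear in `T`
(Bushnell–Henniart 2006, §4.2; Cartier 1979, §IV.1). [folklore] -/
noncomputable def fixedPointsAction :
    heckeAlgebra k G K →ₗ[k] Module.End k (ρ.fixedPoints K) where
  toFun T := (liftRep K ρ ((T : Module.End k (MonoidAlgebra k (G ⧸ K)))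
      (MonoidAlgebra.single ((1 : G) : G ⧸ K) 1))).restrict
    fun _ hv => liftRep_heckeAlgebra_apply_mem_fixedPoints K ρ hv T
  map_add' S T := by
    ext v
    simp
  map_smul' c T := by
    ext v
    simp

/-- Unfolding `fixedPointsAction`: `(v · T) = Φ(T [K]) v`. [folklore] -/
@[simp] theorem coe_fixedPointsAction_apply (T : heckeAlgebra k G K) (v : ρ.fixedPoints K) :
    (fixedPointsAction K ρ T v : V) =
      liftRep K ρ ((T : Module.End k (MonoidAlgebra k (G ⧸ K)))
        (MonoidAlgebra.single ((1 : G) : G ⧸ K) 1)) v :=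
  rfl

/-- The `k`-algebra map `ℋ(G, K)ᵐᵒᵖ →ₐ[k] End_k(V^K)` of the right `ℋ(G, K)`-module structure
on `V^K ≅ Hom_G(k[G ⧸ K], V)`: unital by `liftRep_single_one_apply`, multiplicative (with the
order of factors reversed) by the module law `liftRep_apply_liftRep_heckeAlgebra_apply`
(Bushnell–Henniart 2006, §4.2; Cartier 1979, §IV.1). [folklore] -/
noncomputable def fixedPointsAlgHom :
    (heckeAlgebra k G K)ᵐᵒᵖ →ₐ[k] Module.End k (ρ.fixedPoints K) :=
  AlgHom.ofLinearMap (fixedPointsAction K ρ ∘ₗ (MulOpposite.opLinearEquiv k).symm.toLinearMap)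
    (by
      ext v
      simp only [LinearMap.coe_comp, LinearEquiv.coe_coe, Function.comp_apply,
        MulOpposite.coe_opLinearEquiv_symm, MulOpposite.unop_one, coe_fixedPointsAction_apply,
        OneMemClass.coe_one, Module.End.one_apply, liftRep_single_one_apply K ρ v.2])
    (by
      intro S T
      ext v
      simp [liftRep_apply_liftRep_heckeAlgebra_apply K ρ v.2])

/-- Unfolding `fixedPointsAlgHom`: `op T` acts by `v ↦ Φ(T [K]) v`. [folklore] -/
theorem coe_fixedPointsAlgHom_apply (T : heckeAlgebra k G K) (v : ρ.fixedPoints K) :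
    (fixedPointsAlgHom K ρ (MulOpposite.op T) v : V) =
      liftRep K ρ ((T : Module.End k (MonoidAlgebra k (G ⧸ K)))
        (MonoidAlgebra.single ((1 : G) : G ⧸ K) 1)) v :=
  rfl

/-- For a Hecke pair, `Φ(𝟙_{KgK}) = ∑_{yK ⊆ KgK} ρ(ỹ)` is the Hecke operator `[KgK]`
(both are finite sums over the `K`-orbit of `gK`, `finite_orbit_quotient`). [folklore] -/
theorem liftRep_doubleCosetIndicator [IsHeckeTriple (⊤ : Submonoid G) K K] (g : G) :
    liftRep K ρ (doubleCosetIndicator k G K g) = heckeOperator ρ K g := by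
  rw [doubleCosetIndicator, heckeOperator,
    finsum_mem_eq_finite_toFinset_sum _ (finite_orbit_quotient K g),
    finsum_mem_eq_finite_toFinset_sum _ (finite_orbit_quotient K g), map_sum]
  refine Finset.sum_congr rfl fun y _ => ?_
  rw [liftRep_single, one_smul]

end FixedPointsModule

end heckeAlgebra

section Discharge

variable (k G : Type*) [CommRing k] [Group G] (K : Subgroup G)
  [IsHeckeTriple (⊤ : Submonoid G) K K] {V : Type*} [AddCommGroup V] [Module k V]

/-- **Discharge of `exists_algHom_moduleEnd_fixedPoints`.** For a Hecke pair `(G, K)` and any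
representation `ρ` of `G` on a `k`-module `V`, Frobenius reciprocity
`V^K ≅ Hom_G(k[G ⧸ K], V)`, `v ↦ ([xK] ↦ ρ(x) v)`, makes `V^K` a right module over
`ℋ(G, K) = End_G(k[G ⧸ K])`, i.e. gives the `k`-algebra map `heckeAlgebra.fixedPointsAlgHom` out
of `ℋ(G, K)ᵐᵒᵖ`, and an element `T` with `T [K] = 𝟙_{KgK}` acts by the Hecke operator
`[KgK] = ∑_{yK ⊆ KgK} ρ(y)` (Cartier 1979, §IV.1, as cited on the fact; Bushnell–Henniart
2006, §4.2; Bump 1997, §4.2, paragraph preceding Proposition 4.2.3: "`V^{K₀}` is clearly stable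
under `ℋ_{K₀}` and is a `ℋ_{K₀}`-module"). [cite: Cartier1979, §IV.1] -/
theorem exists_algHom_moduleEnd_fixedPoints_holds :
    exists_algHom_moduleEnd_fixedPoints k G K (V := V) := by
  intro ρ
  refine ⟨heckeAlgebra.fixedPointsAlgHom K ρ, fun T g hT v => ?_⟩
  rw [heckeAlgebra.coe_fixedPointsAlgHom_apply, hT, heckeAlgebra.liftRep_doubleCosetIndicator]

end Discharge

end Literature.NumberTheory.Automorphic
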